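import Mathlib.Analysis.InnerProductSpace.PiL2
import Literature.Geometry.Lorentzian.AsymptoticFlatnessProofs
import Literature.Geometry.Lorentzian.ConformalCoordCurvature
import HarnessLib

/-!
# The coordinate Laplace–Beltrami operator under a perturbation of the metric components,
# and its exact value for the conformally flat components `w⁴ δ`

Pure Fréchet calculus in the `MetricCoord` framework (`CoordCurvature.lean`,
`CoordScalarCurvatureEvolution.lean`: `sharpAt`, `koszulCLM`, `chrAt`, `hessAt`, `lapAt`). Two
groups of results, both used to show that `1/r` is strictly superharmonic far out on an
asymptotically Schwarzschildean end of negative mass (Schoen–Yau 1979, (2.1):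
`Δ(1/r) = (M/r⁴)(1 + O(1/r)) + O(1/r⁵) < 0 for r ≥ σ`):

* **Perturbation bounds** (any finite-dimensional real inner product space `E`): for two
  component fields `G, G₀`, invertible at `y`,
  - `sharpAt_sub_sharpAt` — the resolvent identity `♯ − ♯₀ = ♯ ∘ (G₀ − G) ∘ ♯₀`, and its norm
    form `norm_sharpAt_sub_sharpAt_le`;
  - `norm_sharpAt_le_of_coercive` — `G_y(v,v) ≥ m‖v‖²` forces `‖♯‖ ≤ m⁻¹`;
  - `norm_koszulCLM_apply_le`, `norm_chrAt_apply_le`, `norm_chrAt_sub_chrAt_apply_le`,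
    `norm_hessAt_apply_le`, `norm_hessAt_sub_hessAt_apply_le` — operator bounds for the Koszul
    form, the Christoffel map and the coordinate Hessian and for their dependence on `G`;
  - `abs_lapAt_sub_lapAt_le` — **`|Δ_G f − Δ_{G₀} f| ≤ n (‖♯−♯₀‖ (‖D²f‖ + (3/2)‖Df‖ ‖♯‖ ‖DG‖)
    + (3/2) ‖♯₀‖ ‖Df‖ (‖♯−♯₀‖ ‖DG‖ + ‖♯₀‖ ‖DG − DG₀‖))`** at `y` (`n = dim E`).
* **The conformally flat case** `G₀ = w⁴ δ` (`δ = ⟪·,·⟫`):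
  - `isMetricOn_const_inner`, `chrAt_const` (`Γ_δ = 0`), `inner_sharpAt_const_inner`,
    `sharpAt_const_inner_eq_sum` (Parseval for `♯α`), `mtrAt_const_inner_eq_sum`
    (`tr_δ β = ∑ᵢ β(bᵢ, bᵢ)` in an orthonormal basis);
  - `lapAt_conformal_inner_eq_sum` — **`Δ_{w⁴δ} f = w⁻⁴ (∑ᵢ D²f(bᵢ,bᵢ) + 2(n−2) w⁻¹ ∑ᵢ ∂ᵢw ∂ᵢf)`**
    (the Christoffel symbols of `w⁴ δ` from `IsMetricOn.chrAt_conformal_eq`,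
    `ConformalCoordCurvature.lean`; Besse 1987, Thm. 1.159 (a));
  - `sum_fderiv_fderiv_inv_norm` — `∑ᵢ D²(‖·‖⁻¹)(y)(bᵢ,bᵢ) = (3 − n) ‖y‖⁻³`, so that `1/r` is
    harmonic in dimension three;
  - `lapAt_schwarzschild_inv_norm` — in dimension three, for `w = 1 + M/(2r)`:
    **`Δ_{w⁴δ}(1/r) = M w⁻⁵ r⁻⁴`** exactly (the leading term of Schoen–Yau's (2.1)).

Everything is proved; no statement of `Prop` type is introduced.

## References

* R. Schoen, S.-T. Yau, *On the proof of the positive mass conjecture in general relativity*,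
  Comm. Math. Phys. 65 (1979) 45–76, §2 Step 1, (2.1), p. 48. [SchoenYauPMT1979]
* A. L. Besse, *Einstein manifolds*, Springer 1987, Thm. 1.159 (a). [Besse1987]
* B. O'Neill, *Semi-Riemannian geometry*, Academic Press 1983, Ch. 3, Prop. 3.13, Def. 3.50.
  [ONeill1983]
-/

noncomputable section

set_option maxSynthPendingDepth 3

open Set Filter ContinuousLinearMap Module
open scoped Topology ContDiff RealInnerProductSpace

namespace Literature.Geometry.Lorentzian

namespace MetricCoord

/-! ### Perturbation bounds -/

section Perturbation

variable {E : Type*} [NormedAddCommGroup E] [NormedSpace ℝ E] {G G₀ : E → E →L[ℝ] E →L[ℝ] ℝ}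
  {y : E}

/-- **The resolvent identity for index raising**: `♯ − ♯₀ = ♯ ∘ (G₀ − G) ∘ ♯₀` at a point where
both component fields are invertible. [folklore] -/
theorem sharpAt_sub_sharpAt (hy : (G y).IsInvertible) (hy₀ : (G₀ y).IsInvertible) :
    sharpAt G y - sharpAt G₀ y = (sharpAt G y).comp ((G₀ y - G y).comp (sharpAt G₀ y)) := by
  ext α
  simp only [_root_.sub_apply, ContinuousLinearMap.comp_apply, map_sub,
    apply_sharpAt hy₀, sharpAt_apply hy]

/-- `‖♯ − ♯₀‖ ≤ ‖♯‖ ‖G − G₀‖ ‖♯₀‖`. [folklore] -/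
theorem norm_sharpAt_sub_sharpAt_le (hy : (G y).IsInvertible) (hy₀ : (G₀ y).IsInvertible) :
    ‖sharpAt G y - sharpAt G₀ y‖ ≤ ‖sharpAt G y‖ * ‖G y - G₀ y‖ * ‖sharpAt G₀ y‖ := by
  rw [sharpAt_sub_sharpAt hy hy₀]
  refine (opNorm_comp_le _ _).trans ?_
  rw [mul_assoc]
  refine mul_le_mul_of_nonneg_left ((opNorm_comp_le _ _).trans_eq ?_) (norm_nonneg _)
  rw [norm_sub_rev]

/-- **Coercivity bounds the inverse**: if `G_y(v, v) ≥ m ‖v‖²` with `m > 0` (and `G_y` is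
invertible), then `‖♯‖ ≤ m⁻¹`. [folklore] -/
theorem norm_sharpAt_le_of_coercive (hy : (G y).IsInvertible) {m : ℝ} (hm : 0 < m)
    (hc : ∀ v : E, m * ‖v‖ ^ 2 ≤ G y v v) : ‖sharpAt G y‖ ≤ m⁻¹ := by
  refine opNorm_le_bound _ (inv_nonneg.2 hm.le) fun α ↦ ?_
  set v := sharpAt G y α
  have h1 : m * ‖v‖ ^ 2 ≤ ‖α‖ * ‖v‖ := by
    calc m * ‖v‖ ^ 2 ≤ G y v v := hc v
      _ = α v := apply_sharpAt_apply hy α v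
      _ ≤ ‖α v‖ := Real.le_norm_self _
      _ ≤ ‖α‖ * ‖v‖ := α.le_opNorm v
  by_cases hv : v = 0
  · rw [hv, norm_zero]
    positivity
  · have hvpos : 0 < ‖v‖ := norm_pos_iff.2 hv
    have h2 : m * ‖v‖ ≤ ‖α‖ := by
      have := h1
      rw [pow_two, ← mul_assoc] at this
      exact le_of_mul_le_mul_right this hvpos
    calc ‖v‖ = m⁻¹ * (m * ‖v‖) := by field_simp
      _ ≤ m⁻¹ * ‖α‖ := mul_le_mul_of_nonneg_left h2 (inv_nonneg.2 hm.le)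

/-- A trilinear form is bounded by its operator norm: `|T X Y Z| ≤ ‖T‖ ‖X‖ ‖Y‖ ‖Z‖`. [folklore] -/
theorem norm_apply₃_le (T : E →L[ℝ] E →L[ℝ] E →L[ℝ] ℝ) (X Y Z : E) :
    ‖T X Y Z‖ ≤ ‖T‖ * ‖X‖ * ‖Y‖ * ‖Z‖ :=
  calc ‖T X Y Z‖ ≤ ‖T X Y‖ * ‖Z‖ := (T X Y).le_opNorm Z
    _ ≤ ‖T X‖ * ‖Y‖ * ‖Z‖ := by gcongr; exact (T X).le_opNorm Y
    _ ≤ ‖T‖ * ‖X‖ * ‖Y‖ * ‖Z‖ := by gcongr; exact T.le_opNorm X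

/-- **The Koszul operator is bounded by `3`**: `‖(koszulOp T)(X)‖ ≤ 3 ‖T‖ ‖X‖`. [folklore] -/
theorem norm_koszulOp_apply_le (T : E →L[ℝ] E →L[ℝ] E →L[ℝ] ℝ) (X : E) :
    ‖koszulOp T X‖ ≤ 3 * ‖T‖ * ‖X‖ := by
  refine opNorm_le_bound _ (by positivity) fun Y ↦ opNorm_le_bound _ (by positivity) fun Z ↦ ?_
  rw [koszulOp_apply]
  have h1 := norm_apply₃_le T X Y Z
  have h2 := norm_apply₃_le T Y Z X
  have h3 := norm_apply₃_le T Z X Y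
  calc ‖T X Y Z + T Y Z X - T Z X Y‖ ≤ ‖T X Y Z + T Y Z X‖ + ‖T Z X Y‖ := norm_sub_le _ _
    _ ≤ ‖T X Y Z‖ + ‖T Y Z X‖ + ‖T Z X Y‖ := by gcongr; exact norm_add_le _ _
    _ ≤ 3 * ‖T‖ * ‖X‖ * ‖Y‖ * ‖Z‖ := by nlinarith [norm_nonneg X, norm_nonneg Y, norm_nonneg Z]

/-- `‖K(X, ·, ·)‖ ≤ 3 ‖DG(y)‖ ‖X‖`. [folklore] -/
theorem norm_koszulCLM_apply_le (X : E) : ‖koszulCLM G y X‖ ≤ 3 * ‖fderiv ℝ G y‖ * ‖X‖ :=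
  norm_koszulOp_apply_le _ X

/-- The Koszul form depends linearly on `DG`: `K_G − K_{G₀} = koszulOp (DG − DG₀)`. [folklore] -/
theorem koszulCLM_sub_koszulCLM :
    koszulCLM G y - koszulCLM G₀ y = koszulOp (fderiv ℝ G y - fderiv ℝ G₀ y) := by
  simp only [koszulCLM, map_sub]

/-- `‖(K_G − K_{G₀})(X, ·, ·)‖ ≤ 3 ‖DG − DG₀‖ ‖X‖`. [folklore] -/
theorem norm_koszulCLM_sub_apply_le (X : E) :
    ‖koszulCLM G y X - koszulCLM G₀ y X‖ ≤ 3 * ‖fderiv ℝ G y - fderiv ℝ G₀ y‖ * ‖X‖ := by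
  rw [← _root_.sub_apply, koszulCLM_sub_koszulCLM]
  exact norm_koszulOp_apply_le _ X

/-- The Christoffel endomorphism as a composition: `Γ(X, ·) = ½ ♯ ∘ K(X, ·, ·)`. [folklore] -/
theorem chrAt_apply_eq_comp (X : E) :
    chrAt G y X = (2⁻¹ : ℝ) • (sharpAt G y).comp (koszulCLM G y X) := by
  ext Y
  rw [chrAt_apply]
  rfl

/-- **`‖Γ(X, ·)‖ ≤ (3/2) ‖♯‖ ‖DG‖ ‖X‖`**. [folklore] -/
theorem norm_chrAt_apply_le (X : E) :
    ‖chrAt G y X‖ ≤ 2⁻¹ * (‖sharpAt G y‖ * (3 * ‖fderiv ℝ G y‖ * ‖X‖)) := by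
  rw [chrAt_apply_eq_comp, norm_smul, Real.norm_eq_abs, abs_of_pos (by norm_num : (0 : ℝ) < 2⁻¹)]
  gcongr
  exact (opNorm_comp_le _ _).trans (mul_le_mul_of_nonneg_left (norm_koszulCLM_apply_le X)
    (norm_nonneg _))

/-- **Dependence of the Christoffel map on `G`**:
`‖Γ_G(X,·) − Γ_{G₀}(X,·)‖ ≤ (3/2) (‖♯−♯₀‖ ‖DG‖ + ‖♯₀‖ ‖DG − DG₀‖) ‖X‖`. [folklore] -/
theorem norm_chrAt_sub_chrAt_apply_le (X : E) :
    ‖chrAt G y X - chrAt G₀ y X‖ ≤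
      2⁻¹ * (3 * (‖sharpAt G y - sharpAt G₀ y‖ * ‖fderiv ℝ G y‖
        + ‖sharpAt G₀ y‖ * ‖fderiv ℝ G y - fderiv ℝ G₀ y‖) * ‖X‖) := by
  have hsplit : chrAt G y X - chrAt G₀ y X =
      (2⁻¹ : ℝ) • ((sharpAt G y - sharpAt G₀ y).comp (koszulCLM G y X)
        + (sharpAt G₀ y).comp (koszulCLM G y X - koszulCLM G₀ y X)) := by
    rw [chrAt_apply_eq_comp, chrAt_apply_eq_comp, ← smul_sub]
    congr 1
    ext Z
    simp only [_root_.sub_apply, _root_.add_apply,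
      ContinuousLinearMap.comp_apply, map_sub]
    abel
  rw [hsplit, norm_smul, Real.norm_eq_abs, abs_of_pos (by norm_num : (0 : ℝ) < 2⁻¹)]
  gcongr
  refine (norm_add_le _ _).trans ?_
  have h1 := (opNorm_comp_le (sharpAt G y - sharpAt G₀ y) (koszulCLM G y X)).trans
    (mul_le_mul_of_nonneg_left (norm_koszulCLM_apply_le (G := G) X) (norm_nonneg _))
  have h2 := (opNorm_comp_le (sharpAt G₀ y) (koszulCLM G y X - koszulCLM G₀ y X)).trans
    (mul_le_mul_of_nonneg_left (norm_koszulCLM_sub_apply_le (G := G) (G₀ := G₀) X)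
      (norm_nonneg _))
  nlinarith [h1, h2, norm_nonneg (sharpAt G y - sharpAt G₀ y), norm_nonneg (sharpAt G₀ y),
    norm_nonneg (fderiv ℝ G y), norm_nonneg (fderiv ℝ G y - fderiv ℝ G₀ y), norm_nonneg X]

/-- The coordinate Hessian endomorphism: `Hess f (X, ·) = D²f(X, ·) − Df ∘ Γ(X, ·)`. [folklore] -/
theorem hessAt_apply_eq (f : E → ℝ) (X : E) :
    hessAt G f y X = fderiv ℝ (fderiv ℝ f) y X - (fderiv ℝ f y).comp (chrAt G y X) := by
  ext Z
  simp [hessAt]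

/-- **`‖Hess f (X, ·)‖ ≤ (‖D²f‖ + ‖Df‖ (3/2) ‖♯‖ ‖DG‖) ‖X‖`**. [folklore] -/
theorem norm_hessAt_apply_le (f : E → ℝ) (X : E) :
    ‖hessAt G f y X‖ ≤
      (‖fderiv ℝ (fderiv ℝ f) y‖
        + ‖fderiv ℝ f y‖ * (2⁻¹ * (‖sharpAt G y‖ * (3 * ‖fderiv ℝ G y‖)))) * ‖X‖ := by
  rw [hessAt_apply_eq]
  refine (norm_sub_le _ _).trans ?_
  have h1 : ‖fderiv ℝ (fderiv ℝ f) y X‖ ≤ ‖fderiv ℝ (fderiv ℝ f) y‖ * ‖X‖ :=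
    (fderiv ℝ (fderiv ℝ f) y).le_opNorm X
  have h2 : ‖(fderiv ℝ f y).comp (chrAt G y X)‖ ≤
      ‖fderiv ℝ f y‖ * (2⁻¹ * (‖sharpAt G y‖ * (3 * ‖fderiv ℝ G y‖ * ‖X‖))) :=
    (opNorm_comp_le _ _).trans (mul_le_mul_of_nonneg_left (norm_chrAt_apply_le X) (norm_nonneg _))
  nlinarith [h1, h2]

/-- **Dependence of the coordinate Hessian on `G`**: `Hess_G f − Hess_{G₀} f = −Df ∘ (Γ − Γ₀)`,
so `‖(Hess_G f − Hess_{G₀} f)(X,·)‖ ≤ ‖Df‖ (3/2)(‖♯−♯₀‖ ‖DG‖ + ‖♯₀‖ ‖DG−DG₀‖) ‖X‖`. [folklore] -/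
theorem norm_hessAt_sub_hessAt_apply_le (f : E → ℝ) (X : E) :
    ‖hessAt G f y X - hessAt G₀ f y X‖ ≤
      ‖fderiv ℝ f y‖ * (2⁻¹ * (3 * (‖sharpAt G y - sharpAt G₀ y‖ * ‖fderiv ℝ G y‖
        + ‖sharpAt G₀ y‖ * ‖fderiv ℝ G y - fderiv ℝ G₀ y‖) * ‖X‖)) := by
  have h : hessAt G f y X - hessAt G₀ f y X =
      -(fderiv ℝ f y).comp (chrAt G y X - chrAt G₀ y X) := by
    rw [hessAt_apply_eq, hessAt_apply_eq, ContinuousLinearMap.comp_sub]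
    abel
  rw [h, norm_neg]
  exact (opNorm_comp_le _ _).trans
    (mul_le_mul_of_nonneg_left (norm_chrAt_sub_chrAt_apply_le X) (norm_nonneg _))

end Perturbation

/-! ### Traces in an orthonormal basis and the Laplacian perturbation bound -/

section InnerProduct

variable {E : Type*} [NormedAddCommGroup E] [InnerProductSpace ℝ E] [FiniteDimensional ℝ E]
  {ι : Type*} [Fintype ι] (b : OrthonormalBasis ι ℝ E) {G G₀ : E → E →L[ℝ] E →L[ℝ] ℝ} {y : E}

omit [FiniteDimensional ℝ E] in
/-- The coordinate functionals of an orthonormal basis are the inner products `⟪bᵢ, ·⟫`.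
[folklore] -/
theorem coord_toBasis_apply (i : ι) (v : E) : b.toBasis.coord i v = ⟪b i, v⟫ := by
  rw [Basis.coord_apply, OrthonormalBasis.coe_toBasis_repr_apply, OrthonormalBasis.repr_apply_apply]

omit [FiniteDimensional ℝ E] in
/-- **The metric trace in an orthonormal basis**: `tr_G β = ∑ᵢ ⟪bᵢ, ♯(β(bᵢ, ·))⟫`. [folklore] -/
theorem mtrAt_eq_sum_inner (β : E →L[ℝ] E →L[ℝ] ℝ) :
    mtrAt G y β = ∑ i, ⟪b i, sharpAt G y (β (b i))⟫ := by
  rw [mtrAt, trace_eq_sum_coord b.toBasis]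
  refine Finset.sum_congr rfl fun i _ ↦ ?_
  rw [coord_toBasis_apply, OrthonormalBasis.coe_toBasis]
  rfl

/-- **The Laplacian perturbation bound.** For two component fields `G, G₀` and `f : E → ℝ`,
at a point `y`:
`|Δ_G f − Δ_{G₀} f| ≤ n · (‖♯−♯₀‖ (‖D²f‖ + ‖Df‖ (3/2) ‖♯‖ ‖DG‖)
  + ‖♯₀‖ ‖Df‖ (3/2) (‖♯−♯₀‖ ‖DG‖ + ‖♯₀‖ ‖DG − DG₀‖))`, `n = dim E`
(`Δ = lapAt`, `♯ = sharpAt`, all at `y`): the traces are expanded in an orthonormal basis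
and each term `♯ Hess(bᵢ) − ♯₀ Hess₀(bᵢ)` is split as `(♯ − ♯₀) Hess(bᵢ) + ♯₀ (Hess − Hess₀)(bᵢ)`.
[folklore] -/
theorem abs_lapAt_sub_lapAt_le (f : E → ℝ) :
    |lapAt G f y - lapAt G₀ f y| ≤
      Module.finrank ℝ E *
        (‖sharpAt G y - sharpAt G₀ y‖ * (‖fderiv ℝ (fderiv ℝ f) y‖
            + ‖fderiv ℝ f y‖ * (2⁻¹ * (‖sharpAt G y‖ * (3 * ‖fderiv ℝ G y‖))))
          + ‖sharpAt G₀ y‖ * (‖fderiv ℝ f y‖ * (2⁻¹ * (3 *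
              (‖sharpAt G y - sharpAt G₀ y‖ * ‖fderiv ℝ G y‖
                + ‖sharpAt G₀ y‖ * ‖fderiv ℝ G y - fderiv ℝ G₀ y‖))))) := by
  set b := stdOrthonormalBasis ℝ E
  rw [lapAt, lapAt, mtrAt_eq_sum_inner b, mtrAt_eq_sum_inner b, ← Finset.sum_sub_distrib]
  refine (Finset.abs_sum_le_sum_abs _ _).trans ?_
  have key : ∀ i, |⟪b i, sharpAt G y (hessAt G f y (b i))⟫
      - ⟪b i, sharpAt G₀ y (hessAt G₀ f y (b i))⟫| ≤
      ‖sharpAt G y - sharpAt G₀ y‖ * (‖fderiv ℝ (fderiv ℝ f) y‖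
          + ‖fderiv ℝ f y‖ * (2⁻¹ * (‖sharpAt G y‖ * (3 * ‖fderiv ℝ G y‖))))
        + ‖sharpAt G₀ y‖ * (‖fderiv ℝ f y‖ * (2⁻¹ * (3 *
            (‖sharpAt G y - sharpAt G₀ y‖ * ‖fderiv ℝ G y‖
              + ‖sharpAt G₀ y‖ * ‖fderiv ℝ G y - fderiv ℝ G₀ y‖)))) := fun i ↦ by
    rw [← inner_sub_right]
    have hsplit : sharpAt G y (hessAt G f y (b i)) - sharpAt G₀ y (hessAt G₀ f y (b i)) =
        (sharpAt G y - sharpAt G₀ y) (hessAt G f y (b i))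
          + sharpAt G₀ y (hessAt G f y (b i) - hessAt G₀ f y (b i)) := by
      simp only [_root_.sub_apply, map_sub]
      abel
    calc |⟪b i, sharpAt G y (hessAt G f y (b i)) - sharpAt G₀ y (hessAt G₀ f y (b i))⟫|
          ≤ ‖b i‖ * ‖sharpAt G y (hessAt G f y (b i)) - sharpAt G₀ y (hessAt G₀ f y (b i))‖ :=
            abs_real_inner_le_norm _ _
      _ = ‖sharpAt G y (hessAt G f y (b i)) - sharpAt G₀ y (hessAt G₀ f y (b i))‖ := by
            rw [b.orthonormal.1 i, one_mul]
      _ ≤ ‖(sharpAt G y - sharpAt G₀ y) (hessAt G f y (b i))‖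
            + ‖sharpAt G₀ y (hessAt G f y (b i) - hessAt G₀ f y (b i))‖ := by
            rw [hsplit]; exact norm_add_le _ _
      _ ≤ ‖sharpAt G y - sharpAt G₀ y‖ * ‖hessAt G f y (b i)‖
            + ‖sharpAt G₀ y‖ * ‖hessAt G f y (b i) - hessAt G₀ f y (b i)‖ :=
            add_le_add (le_opNorm _ _) (le_opNorm _ _)
      _ ≤ _ := by
            have h1 := norm_hessAt_apply_le (G := G) (y := y) f (b i)
            have h2 := norm_hessAt_sub_hessAt_apply_le (G := G) (G₀ := G₀) (y := y) f (b i)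
            rw [b.orthonormal.1 i, mul_one] at h1 h2
            gcongr
  calc ∑ i, |⟪b i, sharpAt G y (hessAt G f y (b i))⟫ - ⟪b i, sharpAt G₀ y (hessAt G₀ f y (b i))⟫|
        ≤ ∑ _i : Fin (Module.finrank ℝ E),
          (‖sharpAt G y - sharpAt G₀ y‖ * (‖fderiv ℝ (fderiv ℝ f) y‖
            + ‖fderiv ℝ f y‖ * (2⁻¹ * (‖sharpAt G y‖ * (3 * ‖fderiv ℝ G y‖))))
          + ‖sharpAt G₀ y‖ * (‖fderiv ℝ f y‖ * (2⁻¹ * (3 *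
              (‖sharpAt G y - sharpAt G₀ y‖ * ‖fderiv ℝ G y‖
                + ‖sharpAt G₀ y‖ * ‖fderiv ℝ G y - fderiv ℝ G₀ y‖))))) :=
          Finset.sum_le_sum fun i _ ↦ key i
    _ = _ := by rw [Finset.sum_const, Finset.card_univ, nsmul_eq_mul, Fintype.card_fin]

end InnerProduct

/-! ### The flat components `δ = ⟪·,·⟫` and the conformally flat components `w⁴ δ` -/

section Flat

variable {E : Type*} [NormedAddCommGroup E] [InnerProductSpace ℝ E] [FiniteDimensional ℝ E]
  {δ : E →L[ℝ] E →L[ℝ] ℝ} (hδ : ∀ v w : E, δ v w = ⟪v, w⟫)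

include hδ

/-- The inner product, as a bilinear form `E → E*`, is invertible (nondegenerate in finite
dimension). [folklore] -/
theorem isInvertible_inner : δ.IsInvertible :=
  isInvertible_of_nondegenerate fun v hv ↦ by
    have h := hv v
    rw [hδ, real_inner_self_eq_norm_sq] at h
    exact norm_eq_zero.1 (pow_eq_zero_iff two_ne_zero |>.1 h)

/-- **The flat components are metric components** on every open set: `y ↦ δ` is constant
(smooth), symmetric and invertible. [cite: ONeill1983, Ch. 3, Def. 3.1] -/
theorem isMetricOn_const_inner {V : Set E} (hV : IsOpen V) : IsMetricOn (fun _ : E ↦ δ) V where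
  isOpen := hV
  contDiffOn := contDiffOn_const
  symm _ _ v w := by rw [hδ, hδ, real_inner_comm]
  isInvertible _ _ := isInvertible_inner hδ

omit hδ in
omit [FiniteDimensional ℝ E] in
/-- The Koszul form of constant components vanishes. [folklore] -/
theorem koszulCLM_const (B : E →L[ℝ] E →L[ℝ] ℝ) (y : E) : koszulCLM (fun _ : E ↦ B) y = 0 := by
  rw [koszulCLM, fderiv_fun_const, Pi.zero_apply, map_zero]

omit hδ in
omit [FiniteDimensional ℝ E] in
/-- **The Christoffel map of constant components vanishes**: `Γ_δ = 0` (O'Neill 1983, Ch. 3,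
Prop. 3.13 for constant `g_{ij}`). [cite: ONeill1983, Ch. 3, Prop. 3.13] -/
theorem chrAt_const (B : E →L[ℝ] E →L[ℝ] ℝ) (y : E) : chrAt (fun _ : E ↦ B) y = 0 := by
  ext X Y
  rw [chrAt_apply, koszulCLM_const]
  simp

/-- Index raising for the flat components is the Riesz isomorphism: `⟪♯α, w⟫ = α(w)`. [folklore] -/
theorem inner_sharpAt_const_inner (y : E) (α : E →L[ℝ] ℝ) (w : E) :
    ⟪sharpAt (fun _ : E ↦ δ) y α, w⟫ = α w := by
  rw [← hδ]
  exact apply_sharpAt_apply (G := fun _ : E ↦ δ) (isInvertible_inner hδ) α w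

/-- **Parseval for `♯α`**: `♯α = ∑ᵢ α(bᵢ) bᵢ` in an orthonormal basis. [folklore] -/
theorem sharpAt_const_inner_eq_sum {ι : Type*} [Fintype ι] (b : OrthonormalBasis ι ℝ E) (y : E)
    (α : E →L[ℝ] ℝ) : sharpAt (fun _ : E ↦ δ) y α = ∑ i, α (b i) • b i := by
  conv_lhs => rw [← b.sum_repr' (sharpAt (fun _ : E ↦ δ) y α)]
  refine Finset.sum_congr rfl fun i _ ↦ ?_
  rw [real_inner_comm, inner_sharpAt_const_inner hδ]

/-- **The flat metric trace is the ordinary trace**: `tr_δ β = ∑ᵢ β(bᵢ, bᵢ)` in an orthonormal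
basis. [cite: ONeill1983, Ch. 3, pp. 60–61] -/
theorem mtrAt_const_inner_eq_sum {ι : Type*} [Fintype ι] (b : OrthonormalBasis ι ℝ E) (y : E)
    (β : E →L[ℝ] E →L[ℝ] ℝ) : mtrAt (fun _ : E ↦ δ) y β = ∑ i, β (b i) (b i) := by
  rw [mtrAt_eq_sum_inner b]
  refine Finset.sum_congr rfl fun i _ ↦ ?_
  rw [real_inner_comm, inner_sharpAt_const_inner hδ]

/-- **The Laplace–Beltrami operator of the conformally flat components `w⁴ δ`** in an
orthonormal basis `(bᵢ)`, `n = card ι = dim E`: for `w` smooth and nowhere zero on an open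
`V ∋ y`,
`Δ_{w⁴δ} f (y) = w(y)⁻⁴ (∑ᵢ D²f(y)(bᵢ,bᵢ) + 2 (n − 2) w(y)⁻¹ ∑ᵢ ∂_{bᵢ}w(y) ∂_{bᵢ}f(y))`
— the Christoffel symbols of `w⁴ δ` are the difference tensor `C` alone (`Γ_δ = 0`,
`IsMetricOn.chrAt_conformal_eq`, Besse 1987, Thm. 1.159 (a)), with `θ = 2 dw/w`, `T = 2 ∇w/w`,
`∑ᵢ C(bᵢ, bᵢ) = (2 − n) T`. [cite: Besse1987, Thm. 1.159 (a)] -/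
theorem lapAt_conformal_inner_eq_sum {ι : Type*} [Fintype ι] (b : OrthonormalBasis ι ℝ E)
    {V : Set E} (hV : IsOpen V) {w : E → ℝ} (hw : ContDiffOn ℝ ∞ w V) (hw0 : ∀ z ∈ V, w z ≠ 0)
    {y : E} (hy : y ∈ V) (f : E → ℝ) :
    lapAt (fun z ↦ w z ^ 4 • δ) f y =
      (w y ^ 4)⁻¹ * (∑ i, fderiv ℝ (fderiv ℝ f) y (b i) (b i)
        + 2 * (Fintype.card ι - 2 : ℝ) * (w y)⁻¹
            * ∑ i, fderiv ℝ w y (b i) * fderiv ℝ f y (b i)) := by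
  have hG : IsMetricOn (fun _ : E ↦ δ) V := isMetricOn_const_inner hδ hV
  have hc : ContDiffOn ℝ ∞ (fun z ↦ w z ^ 4) V := hw.pow 4
  have hc0 : ∀ z ∈ V, w z ^ 4 ≠ 0 := fun z hz ↦ pow_ne_zero 4 (hw0 z hz)
  have hi : δ.IsInvertible := isInvertible_inner hδ
  have hi' : ((fun z ↦ w z ^ 4 • δ) y).IsInvertible :=
    (isMetricOn_conformal hG hc hc0).isInvertible y hy
  have hwy := hw0 y hy
  have hwd : DifferentiableAt ℝ w y := hG.differentiableAt_of_contDiffOn hw hy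
  -- the conformal one-form `θ = 2 dw / w` and the Christoffel map `Γ' = C`
  have hθ : confForm (fun z ↦ w z ^ 4) y = (2 * (w y)⁻¹) • fderiv ℝ w y :=
    confForm_fourth_power hwd hwy
  have hΓ : ∀ X Y : E, chrAt (fun z ↦ w z ^ 4 • δ) y X Y =
      confDiff (fun _ : E ↦ δ) (fun z ↦ w z ^ 4) y X Y := fun X Y ↦ by
    rw [hG.chrAt_conformal_eq hc hc0 hy, chrAt_const, _root_.zero_apply, _root_.zero_apply,
      zero_add]
  -- `Df(T) = ∑ᵢ θ(bᵢ) Df(bᵢ)` by Parseval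
  have hT : fderiv ℝ f y (confVec (fun _ : E ↦ δ) (fun z ↦ w z ^ 4) y) =
      ∑ i, confForm (fun z ↦ w z ^ 4) y (b i) * fderiv ℝ f y (b i) := by
    rw [confVec, sharpAt_const_inner_eq_sum hδ b, map_sum]
    exact Finset.sum_congr rfl fun i _ ↦ by rw [map_smul, smul_eq_mul]
  rw [lapAt, mtrAt_conformal (G := fun _ : E ↦ δ) (c := fun z ↦ w z ^ 4) hi hi' (hc0 y hy),
    mtrAt_const_inner_eq_sum hδ b]
  have hone : ∀ i, δ (b i) (b i) = 1 := fun i ↦ by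
    rw [hδ, real_inner_self_eq_norm_sq, b.orthonormal.1 i, one_pow]
  simp only [hessAt_apply, hΓ, confDiff, map_add, map_sub, map_smul, smul_eq_mul, hone, one_mul,
    Finset.sum_sub_distrib, Finset.sum_add_distrib, hT]
  simp only [hθ, _root_.smul_apply, smul_eq_mul, Finset.sum_const, Finset.card_univ,
    nsmul_eq_mul]
  simp only [Finset.mul_sum, ← Finset.sum_add_distrib, ← Finset.sum_sub_distrib]
  exact Finset.sum_congr rfl fun i _ ↦ by ring

omit hδ in
omit [FiniteDimensional ℝ E] in
/-- Evaluation of the inner product read as a bilinear map `E →L E →L ℝ`. [folklore] -/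
theorem innerSL_bilin_apply (v w : E) : (innerSL ℝ : E →L[ℝ] E →L[ℝ] ℝ) v w = ⟪v, w⟫ := rfl

omit hδ in
omit [FiniteDimensional ℝ E] in
/-- **`1/r` is harmonic in dimension three** (and `Δ(1/r) = (3 − n) r⁻³` in general): in an
orthonormal basis, `∑ᵢ D²(‖·‖⁻¹)(y)(bᵢ, bᵢ) = (3 − n) ‖y‖⁻³` for `y ≠ 0`
(`D²(1/r) = −r⁻³ ⟪·,·⟫ + 3 r⁻⁵ ⟪y,·⟫⟪y,·⟫`, `hasFDerivAt_fderiv_inv_norm`). [folklore] -/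
theorem sum_fderiv_fderiv_inv_norm {ι : Type*} [Fintype ι] (b : OrthonormalBasis ι ℝ E)
    {y : E} (hy : y ≠ 0) :
    ∑ i, fderiv ℝ (fderiv ℝ fun z : E ↦ ‖z‖⁻¹) y (b i) (b i) =
      (3 - Fintype.card ι : ℝ) * (‖y‖ ^ 3)⁻¹ := by
  have hy' : ‖y‖ ≠ 0 := norm_ne_zero_iff.2 hy
  have hone : ∀ i, ⟪b i, b i⟫ = 1 := fun i ↦ by
    rw [real_inner_self_eq_norm_sq, b.orthonormal.1 i, one_pow]
  have key : ∀ v w : E, fderiv ℝ (fderiv ℝ fun z : E ↦ ‖z‖⁻¹) y v w =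
      -(‖y‖ ^ 3)⁻¹ * ⟪v, w⟫ + 3 * ‖y‖ ^ 2 / (‖y‖ ^ 3) ^ 2 * (‖y‖⁻¹ * ⟪y, v⟫) * ⟪y, w⟫ :=
      fun v w ↦ by
    rw [(hasFDerivAt_fderiv_inv_norm hy).fderiv]
    rfl
  simp only [key, hone, mul_one, Finset.sum_add_distrib, Finset.sum_const, Finset.card_univ,
    nsmul_eq_mul]
  have hP : ∑ i, ⟪y, b i⟫ * ⟪y, b i⟫ = ‖y‖ ^ 2 := by
    rw [← real_inner_self_eq_norm_sq, ← b.sum_inner_mul_inner y y]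
    exact Finset.sum_congr rfl fun i _ ↦ by rw [real_inner_comm (b i) y]
  have hsum : ∀ a : ℝ, ∑ i, a * (‖y‖⁻¹ * ⟪y, b i⟫) * ⟪y, b i⟫ = a * ‖y‖⁻¹ * ‖y‖ ^ 2 := fun a ↦ by
    rw [← hP, Finset.mul_sum]
    exact Finset.sum_congr rfl fun i _ ↦ by ring
  rw [hsum]
  field_simp
  ring

/-- **The Laplacian of `1/r` for the Schwarzschild conformal factor**, in dimension three:
with `w = 1 + M/(2r)`, `Δ_{w⁴δ}(1/r)(y) = M w(y)⁻⁵ ‖y‖⁻⁴` exactly, for `‖y‖ > |M|` (where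
`w ≥ ½`) — the leading term `(M/r⁴)(1 + O(1/r))` of Schoen–Yau 1979, (2.1):
`Δ_{w⁴δ} = w⁻⁴ (Δ_δ + 2 w⁻¹ ⟨∇w, ∇·⟩)`, `Δ_δ(1/r) = 0`, `∇w = (M/2) ∇(1/r)`,
`|∇(1/r)|² = r⁻⁴`. [cite: SchoenYauPMT1979, §2 Step 1, (2.1) (p. 48)] -/
theorem lapAt_schwarzschild_inv_norm {ι : Type*} [Fintype ι] (b : OrthonormalBasis ι ℝ E)
    (h3 : Fintype.card ι = 3) (M : ℝ) {y : E} (hy : |M| < ‖y‖) :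
    lapAt (fun z : E ↦ (1 + M / (2 * ‖z‖)) ^ 4 • δ) (fun z : E ↦ ‖z‖⁻¹) y =
      M * ((1 + M / (2 * ‖y‖)) ^ 5)⁻¹ * (‖y‖ ^ 4)⁻¹ := by
  -- the open set `{|M| < ‖z‖}`, on which `w = 1 + M/(2r) ≥ 1/2` is smooth
  set V : Set E := {z | |M| < ‖z‖} with hV
  have hVo : IsOpen V := isOpen_lt continuous_const continuous_norm
  have hne : ∀ z ∈ V, z ≠ 0 := fun z hz ↦ by
    rintro rfl
    have hz' : |M| < ‖(0 : E)‖ := hz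
    rw [norm_zero] at hz'
    linarith [abs_nonneg M]
  have hwpos : ∀ z ∈ V, 0 < 1 + M / (2 * ‖z‖) := fun z hz ↦ by
    have hz' : |M| < ‖z‖ := hz
    have hzpos : 0 < ‖z‖ := (abs_nonneg M).trans_lt hz'
    have : |M / (2 * ‖z‖)| < 1 := by
      rw [abs_div, abs_of_pos (by positivity : (0 : ℝ) < 2 * ‖z‖), div_lt_one (by positivity)]
      linarith
    linarith [neg_abs_le (M / (2 * ‖z‖))]
  have hnorm : ContDiffOn ℝ ∞ (fun z : E ↦ ‖z‖) V := fun z hz ↦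
    (contDiffAt_norm ℝ (hne z hz)).contDiffWithinAt
  have hw : ContDiffOn ℝ ∞ (fun z : E ↦ 1 + M / (2 * ‖z‖)) V :=
    contDiffOn_const.add (contDiffOn_const.div (contDiffOn_const.mul hnorm)
      fun z hz ↦ mul_ne_zero two_ne_zero (norm_ne_zero_iff.2 (hne z hz)))
  have hy0 : y ≠ 0 := hne y hy
  have hyn : ‖y‖ ≠ 0 := norm_ne_zero_iff.2 hy0
  rw [lapAt_conformal_inner_eq_sum hδ b hVo hw (fun z hz ↦ (hwpos z hz).ne') hy,
    sum_fderiv_fderiv_inv_norm b hy0, h3]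
  -- `Dw = (M/2) D(1/r)` and `∑ᵢ (∂ᵢ(1/r))² = r⁻⁴`
  have hDu : fderiv ℝ (fun z : E ↦ ‖z‖⁻¹) y = (-(‖y‖ ^ 3)⁻¹) • (innerSL ℝ y : E →L[ℝ] ℝ) :=
    (hasFDerivAt_inv_norm hy0).fderiv
  have hDw : fderiv ℝ (fun z : E ↦ 1 + M / (2 * ‖z‖)) y =
      (M / 2) • fderiv ℝ (fun z : E ↦ ‖z‖⁻¹) y := by
    have h := ((hasFDerivAt_inv_norm hy0).const_mul (M / 2)).const_add 1
    rw [hDu]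
    refine (HasFDerivAt.fderiv (h.congr_of_eventuallyEq (Filter.Eventually.of_forall fun z ↦ ?_)))
    simp only [div_eq_mul_inv, mul_inv]
    ring
  have hP : ∑ i, ⟪y, b i⟫ * ⟪y, b i⟫ = ‖y‖ ^ 2 := by
    rw [← real_inner_self_eq_norm_sq, ← b.sum_inner_mul_inner y y]
    exact Finset.sum_congr rfl fun i _ ↦ by rw [real_inner_comm (b i) y]
  simp only [hDw, hDu, _root_.smul_apply, smul_eq_mul, innerSL_apply_apply, Nat.cast_ofNat]
  have hsum : ∀ a c : ℝ, ∑ i, a * (c * ⟪y, b i⟫) * (c * ⟪y, b i⟫) = a * c ^ 2 * ‖y‖ ^ 2 := by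
    intro a c
    rw [← hP, Finset.mul_sum]
    exact Finset.sum_congr rfl fun i _ ↦ by ring
  rw [hsum]
  have hw0 : 1 + M / (2 * ‖y‖) ≠ 0 := (hwpos y hy).ne'
  generalize 1 + M / (2 * ‖y‖) = w at hw0 ⊢
  field_simp
  ring

end Flat

end MetricCoord

end Literature.Geometry.Lorentzian

end
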